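import Literature.AlgebraicGeometry.Frobenioids.Prop25SubFourFold
import Literature.AlgebraicGeometry.Frobenioids.UnitLinearFrobenius
import HarnessLib

/-!
# [FrdI] Proposition 2.5 (iii), sub-DAG rows P25-L05 – L08: the assignment `φ ↦ Ψ(φ)` IS the
# landed unit-linear Frobenius functor — discharge of `PsiCompIstr`, `PsiComp`, `PsiUnitLinearData`,
# `PsiEquivalence`

Mochizuki, *The geometry of Frobenioids I: the general theory*, Kyushu J. Math. **62** (2008)
293–400, §2, proof of Proposition 2.5 (iii), kurims text p. 49 l. 30 – p. 50 l. 22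
[cite: MochizukiFrdI2008, Prop. 2.5(iii) p.49].

PROOF-ONLY companion of `Prop25Sub.lean` (statements, abc-iut-L1-t2, p414336; sub-DAG
`plan/L1/SUBDAG-FrdI-Prop25-Cor26.md`).  The rows P25-L04 – L08 cut the printed construction of
`Ψ : C ⥲ C(d)` — "we set `Ψ(β) := β₀ · β₁^d` … `Ψ(φ) := α ∘ Ψ(β) ∘ γ ∘ δ` … independent of the choice
of factorization … compatible with composites … a functor `Ψ : C → C(d)` which satisfies (a), (b) …
essentially surjective, faithful, and full" — into named intermediate statements over the predicate
`IsPsiValue τ d φ ψ` ("`ψ` is a value of the construction at `φ`").  The construction itself is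
LANDED: `PreFrobenioid.CharacteristicSplitting.unitLinearMap` / `unitLinearFrobeniusData`
(`UnitLinearFrobenius.lean`, abc-iut-L6-t9, p411338), built from the same splitting
`β = β₀ · β₁` (`LiftedSplitting.lean`, `τ'(A)` = `τ(A^istr)` pulled back along the chosen hull) and
the same formula `Ψ(β) = β₀ · β₁^d` (`UnitLinearPower.lean`).  This file proves the bridge

  `IsPsiValue τ d φ ψ ↔ ψ = unitLinearMap … φ`                (`isPsiValue_iff`)

— (→): `Ψ` is a functor, the identity on the isometries `δ, γ, α` of a four-fold factorisation, and
`Ψ(β₁ ≫ β₀) = β₁^d ≫ β₀` for `β₀ ∈ O^×`, `β₁ ∈ τ` (read through ANY isotropic hull: two isotropic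
hulls of an object are isomorphic under it and `τ` is a subfunctor along isomorphisms of `C^istr`,
`inTauVia_iff_mem_liftedTau`); (←): the four-fold factorisation of row P25-L01
(`fourFoldFactorisation_holds`, abc-iut-L1-t2) and the splitting `O^▷(Y) = O^×(Y) · τ'(Y)` — and
closes the rows BY NAME: `psiCompIstr_holds` (L05), `psiComp_holds` (L06),
`psiUnitLinearData_holds` (L07), `psiEquivalence_holds` (L08).  (Row P25-L04 `PsiMapWellDefined` —
`∃!` of the `Ψ`-value — is the holder abc-iut-L1-t2's `psiMapWellDefined_holds`, by the print's
route through the functoriality of `τ`; it is also immediate from `isPsiValue_iff`.)  No new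
definitions; no side taken on anything beyond [FrdI] §2; typed ≠ proved elsewhere.
-/

namespace Literature.AlgebraicGeometry.Frobenioids

open CategoryTheory Opposite

namespace FrdI.P25

open PreFrobenioid PreFrobenioid.CharacteristicSplitting

universe w v v' u u'

variable {D : Type u} [Category.{v} D] {Φ : Dᵒᵖ ⥤ CommMonCat.{w}}
  {C : Type u'} [Category.{v'} C] {F : C ⥤ ElemFrobenioid Φ}

/-! ### `τ` read through an arbitrary isotropic hull = `τ'` (the chosen hull) -/

/-- "`β₁ ∈ τ(A)` [which applies even if `A` is not isotropic — cf. Definition 2.3, (a), (b)]" does not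
depend on the isotropic hull through which it is read: for ANY isotropic hull `h : Y → Y'`,
`InTauVia τ h β₁` iff `β₁ ∈ τ'(Y)` (the pull-back of `τ` along the CHOSEN hull `Y → Y^istr` of
`LiftedSplitting.lean`) — two isotropic hulls are isomorphic under `Y` (Def. 1.3 (vii)(a)) and `τ` is a
subfunctor along the (linear) comparison isomorphism (Def. 2.3). [cite: MochizukiFrdI2008, Def. 2.3 p.47] -/
theorem inTauVia_iff_mem_liftedTau (hF : IsFrobenioid F) (τ : CharacteristicSplitting F) {Y Y' : C}
    {h : Y ⟶ Y'} (hh : IsIsotropicHull F h) {β₁ : Y ⟶ Y} (hβ₁ : (β₁ : End Y) ∈ endSubmonoid F Y) :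
    InTauVia τ h β₁ ↔ (⟨β₁, hβ₁⟩ : endSubmonoid F Y) ∈ liftedTau hF τ Y := by
  have hP := hF.isPreFrobenioid
  have hh₀ := isIsotropicHull_hullHom hF Y
  -- the comparison isomorphism `e : Y' ≅ Y^istr` under `Y`
  obtain ⟨e, he⟩ := IsIsotropicHull.unique hP.isTotallyEpimorphic hh hh₀
  have he' : hullHom hF Y ≫ e.inv = h := by rw [← he, Category.assoc, e.hom_inv_id, Category.comp_id]
  rw [mem_liftedTau_iff]
  constructor
  · rintro ⟨t, ht, hsq⟩
    -- the transport of `t` to `Y^istr` is the image of `β₁` under `O^▷(Y) ↪ O^▷(Y^istr)`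
    have hlift : e.inv ≫ t ≫ e.hom = ((hullMap hh₀ ⟨β₁, hβ₁⟩).1 : End (hullObj hF Y)) := by
      apply hullLift_unique hh₀
      show hullHom hF Y ≫ e.inv ≫ t ≫ e.hom = β₁ ≫ hullHom hF Y
      rw [reassoc_of% he', reassoc_of% hsq, he]
    rw [← hlift]
    refine τ.res_mem hh₀.2.2.1 hh.2.2.1 e.inv (isLinear_of_isIso F e.inv) t ht (e.inv ≫ t ≫ e.hom) ?_ ?_
    · rw [hlift]; exact (hullMap hh₀ ⟨β₁, hβ₁⟩).2
    · show e.inv ≫ t = (e.inv ≫ t ≫ e.hom) ≫ e.inv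
      simp only [Category.assoc, Iso.hom_inv_id, Category.comp_id]
  · intro hs
    -- transport the image `s` of `β₁` in `τ(Y^istr)` back to `Y'`
    have hsq₀ := hullMap_spec hh₀ ⟨β₁, hβ₁⟩
    dsimp only at hsq₀
    refine ⟨e.hom ≫ ((hullMap hh₀ ⟨β₁, hβ₁⟩).1 : End (hullObj hF Y)) ≫ e.inv, ?_, ?_⟩
    · have hlift : e.hom ≫ ((hullMap hh₀ ⟨β₁, hβ₁⟩).1 : End (hullObj hF Y)) ≫ e.inv =
          ((hullMap hh ⟨β₁, hβ₁⟩).1 : End Y') := by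
        apply hullLift_unique hh
        show h ≫ e.hom ≫ _ ≫ e.inv = β₁ ≫ h
        rw [reassoc_of% he, reassoc_of% hsq₀, he']
      refine τ.res_mem hh.2.2.1 hh₀.2.2.1 e.hom (isLinear_of_isIso F e.hom) _ hs _ ?_ ?_
      · rw [hlift]; exact (hullMap hh ⟨β₁, hβ₁⟩).2
      · show e.hom ≫ _ = (e.hom ≫ _ ≫ e.inv) ≫ e.hom
        simp only [Category.assoc, Iso.inv_hom_id, Category.comp_id]
    · show h ≫ e.hom ≫ _ ≫ e.inv = β₁ ≫ h
      rw [reassoc_of% he, reassoc_of% hsq₀, he']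

/-! ### `Ψ` on a split endomorphism: `Ψ(β₁ ≫ β₀) = β₁^d ≫ β₀` -/

section Psi

variable (hF : IsFrobenioid F) (τ : CharacteristicSplitting F) (hmt : IsOfType (IsMetricallyTrivial F))
  (haa : IsOfType (IsAutAmple F)) (hnorm : IsOfType (IsFrobeniusNormalized F)) (d : ℕ+)

/-- **The text's formula `Ψ(β) := β₀ · β₁^d`** for the landed functor: for `β₀ ∈ O^×(Y)` and
`β₁ ∈ τ'(Y)`, `Ψ(β₁ ≫ β₀) = β₁^d ≫ β₀`. [cite: MochizukiFrdI2008, Prop. 2.5(iii) p.49] -/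
theorem unitLinearMap_split {Y : C} {β₀ : Aut Y} (hβ₀ : β₀ ∈ unitsSubgroup F Y) {β₁ : Y ⟶ Y}
    (hβ₁ : (β₁ : End Y) ∈ endSubmonoid F Y) (hτ : (⟨β₁, hβ₁⟩ : endSubmonoid F Y) ∈ liftedTau hF τ Y) :
    unitLinearMap hF τ hmt haa (powEnd Φ d) hnorm (β₁ ≫ β₀.hom) =
      ((show End Y from β₁) ^ (d : ℕ) : End Y) ≫ β₀.hom := by
  have hP := hF.isPreFrobenioid
  let u : endSubmonoid F Y := ⟨(β₀.hom : End Y), hβ₀.1, hβ₀.2⟩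
  let t : endSubmonoid F Y := ⟨β₁, hβ₁⟩
  have hu : IsUnit u := (isUnit_endSubmonoid_iff F u).mpr ⟨β₀, hβ₀, rfl⟩
  have h1 := unitLinearMap_eq_of_factorization hF τ hmt haa (powEnd Φ d) hnorm
    (isIsometry_of_isIso F hP (𝟙 Y)) (u * t) (isIsometry_of_isIso F hP (𝟙 Y))
  simp only [Category.id_comp, Category.comp_id] at h1
  have h2 : tauPow hF τ hmt haa (powEnd Φ d) Y t = t ^ (d : ℕ) :=
    tauPow_eq hF τ hmt haa _ (pow_mem hτ _) (by rw [map_pow]; rfl)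
  rw [unitLinearPow_eq hF τ hmt haa _ hu hτ rfl, h2] at h1
  exact h1

/-- **`Ψ` on a four-fold factorisation**: if `φ = δ ≫ γ ≫ β ≫ α` as in `IsFourFold` and
`β = β₁ ≫ β₀` with `β₀ ∈ O^×(Y)`, `β₁ ∈ τ'(Y)`, then `Ψ(φ) = δ ≫ γ ≫ (β₁^d ≫ β₀) ≫ α` — the text's
"`Ψ(φ) := α ∘ Ψ(β) ∘ γ ∘ δ`" (`Ψ` is a functor and the identity on the isometries `δ, γ, α`).
[cite: MochizukiFrdI2008, Prop. 2.5(iii) p.49] -/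
theorem unitLinearMap_fourFold {A B X Y : C} {φ : A ⟶ B} {δ' : A ⟶ X} {γ : X ⟶ Y} {β : Y ⟶ Y}
    {α : Y ⟶ B} (hff : IsFourFold F φ δ' γ β α) {β₀ : Aut Y} (hβ₀ : β₀ ∈ unitsSubgroup F Y)
    {β₁ : Y ⟶ Y} (hβ₁ : (β₁ : End Y) ∈ endSubmonoid F Y)
    (hτ : (⟨β₁, hβ₁⟩ : endSubmonoid F Y) ∈ liftedTau hF τ Y) (hβ : β = β₁ ≫ β₀.hom) :
    unitLinearMap hF τ hmt haa (powEnd Φ d) hnorm φ =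
      δ' ≫ γ ≫ ((show End Y from β₁) ^ (d : ℕ) : End Y) ≫ β₀.hom ≫ α := by
  obtain ⟨hδ, ⟨hγi, -⟩, -, hα, hfac⟩ := hff
  have hαi : IsIsometry F α := (hF.iv_b α hα).1.2
  rw [← hfac, unitLinearMap_comp hF τ hmt haa _ hnorm, unitLinearMap_comp hF τ hmt haa _ hnorm,
    unitLinearMap_comp hF τ hmt haa _ hnorm, unitLinearMap_of_isIsometry hF τ hmt haa _ hnorm hδ.1.2,
    unitLinearMap_of_isIsometry hF τ hmt haa _ hnorm hγi,
    unitLinearMap_of_isIsometry hF τ hmt haa _ hnorm hαi, hβ,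
    unitLinearMap_split hF τ hmt haa hnorm d hβ₀ hβ₁ hτ, Category.assoc]

/-- **`IsPsiValue` = equality with the landed `Ψ`**: `ψ` is a value of the printed construction at
`φ` iff `ψ = Ψ(φ)` for the unit-linear Frobenius functor of `UnitLinearFrobenius.lean`.  (→): the
formula on a four-fold factorisation; (←): row P25-L01 (a four-fold factorisation exists,
`fourFoldFactorisation_holds`) and the splitting `O^▷(Y) = O^×(Y) · τ'(Y)` (`exists_liftedTau_split`).
[cite: MochizukiFrdI2008, Prop. 2.5(iii) p.50] -/
theorem isPsiValue_iff {A B : C} (φ ψ : A ⟶ B) :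
    IsPsiValue τ d φ ψ ↔ ψ = unitLinearMap hF τ hmt haa (powEnd Φ d) hnorm φ := by
  have hP := hF.isPreFrobenioid
  constructor
  · rintro ⟨X, Y, Y', δ', γ, β, α, h, β₀, β₁, hff, hh, hβ₀, hβ₁, hτ, hβ, hψ⟩
    rw [hψ, unitLinearMap_fourFold hF τ hmt haa hnorm d hff hβ₀ hβ₁
      ((inTauVia_iff_mem_liftedTau hF τ hh hβ₁).mp hτ) hβ]
  · rintro rfl
    obtain ⟨X, Y, δ', γ, β, α, hff⟩ := fourFoldFactorisation_holds (F := F) ⟨hF, hnorm, hmt, haa⟩ φ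
    have hβmem : (β : End Y) ∈ endSubmonoid F Y := hff.2.2.1
    obtain ⟨t, ht, u, hu, hut⟩ := exists_liftedTau_split hF τ ⟨β, hβmem⟩
    obtain ⟨β₀, hβ₀, hβ₀u⟩ := (isUnit_endSubmonoid_iff F u).mp hu
    have hβ : β = (t.1 : Y ⟶ Y) ≫ β₀.hom := by
      have e := congrArg (fun x : endSubmonoid F Y => (x.1 : Y ⟶ Y)) hut
      rw [hβ₀u]
      exact e
    refine ⟨X, Y, hullObj hF Y, δ', γ, β, α, hullHom hF Y, β₀, t.1, hff, isIsotropicHull_hullHom hF Y,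
      hβ₀, t.2, (inTauVia_iff_mem_liftedTau hF τ (isIsotropicHull_hullHom hF Y) t.2).mpr ht, hβ, ?_⟩
    rw [unitLinearMap_fourFold hF τ hmt haa hnorm d hff hβ₀ t.2 ht hβ]

end Psi

/-! ### The rows -/

/-- **Row P25-L05 `PsiCompIstr` DISCHARGED**: `Ψ`-values compose on `Arr(C^istr)` (p. 50 ll. 7–14:
for the landed functor, `unitLinearIstr_comp` — Prop. 1.11 (iii) lifts, Frobenius-normalisation and
the naturality of `Ψ_A`, `UnitLinearIsotropic.lean`). [cite: MochizukiFrdI2008, Prop. 2.5(iii) p.50] -/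
theorem psiCompIstr_holds (τ : CharacteristicSplitting F) (d : ℕ+) :
    Literature.AlgebraicGeometry.Frobenioids.FrdI.P25.PsiCompIstr F τ d := by
  intro hS X Y Z _ _ _ φ ψ φ' ψ' hφ hψ
  rw [isPsiValue_iff hS.isFrobenioid τ hS.metricallyTrivial hS.autAmple hS.frobeniusNormalized d]
    at hφ hψ ⊢
  rw [hφ, hψ, unitLinearMap_comp]

/-- **Row P25-L06 `PsiComp` DISCHARGED**: `Ψ(id) = id` and `Ψ`-values compose for arbitrary arrows
(p. 50 ll. 14–18: "since isotropic hulls are monomorphisms …" — for the landed functor,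
`unitLinearMap_id` / `unitLinearMap_comp`, which descend `unitLinearIstr_comp` along the hulls).
[cite: MochizukiFrdI2008, Prop. 2.5(iii) p.50] -/
theorem psiComp_holds (τ : CharacteristicSplitting F) (d : ℕ+) :
    Literature.AlgebraicGeometry.Frobenioids.FrdI.P25.PsiComp F τ d := by
  intro hS
  refine ⟨fun A => ?_, fun X Y Z φ ψ φ' ψ' hφ hψ => ?_⟩
  · rw [isPsiValue_iff hS.isFrobenioid τ hS.metricallyTrivial hS.autAmple hS.frobeniusNormalized d,
      unitLinearMap_id]
  · rw [isPsiValue_iff hS.isFrobenioid τ hS.metricallyTrivial hS.autAmple hS.frobeniusNormalized d]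
      at hφ hψ ⊢
    rw [hφ, hψ, unitLinearMap_comp]

/-- **Row P25-L07 `PsiUnitLinearData` DISCHARGED**: the landed `unitLinearFrobeniusData` is a
unit-linear Frobenius datum realising the `Ψ`-values ((a) identity on objects and isometries) and
(b) `1`-compatible — in fact with identity components — with the Frobenius functor of degree `d` on
`F_Φ` (`unitLinearFrobeniusData_oneCommutes`). [cite: MochizukiFrdI2008, Prop. 2.5(iii) p.49] -/
theorem psiUnitLinearData_holds (τ : CharacteristicSplitting F) (d : ℕ+) :
    Literature.AlgebraicGeometry.Frobenioids.FrdI.P25.PsiUnitLinearData F τ d := by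
  intro hS
  refine ⟨unitLinearFrobeniusData hS.isFrobenioid τ hS.metricallyTrivial hS.autAmple (powEnd Φ d)
    hS.frobeniusNormalized, fun A B φ => ?_, ?_⟩
  · exact (isPsiValue_iff hS.isFrobenioid τ hS.metricallyTrivial hS.autAmple hS.frobeniusNormalized d
      φ _).mpr rfl
  · exact unitLinearFrobeniusData_oneCommutes hS.isFrobenioid τ hS.metricallyTrivial hS.autAmple
      (powEnd Φ d) hS.frobeniusNormalized

/-- A unit-linear Frobenius datum realising the `Ψ`-values IS the landed one (its action on arrows is
determined, by `isPsiValue_iff`; the remaining fields are propositions).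
[cite: MochizukiFrdI2008, Prop. 2.5(iii) p.50] -/
theorem unitLinearFrobeniusData_eq_of_isPsiValue (hS : Setting F) (τ : CharacteristicSplitting F)
    (d : ℕ+) (U : UnitLinearFrobeniusData F (powEnd Φ d))
    (hU : ∀ ⦃A B : C⦄ (φ : A ⟶ B), IsPsiValue τ d φ (U.map φ)) :
    U = unitLinearFrobeniusData hS.isFrobenioid τ hS.metricallyTrivial hS.autAmple (powEnd Φ d)
      hS.frobeniusNormalized := by
  have hmap : ∀ ⦃A B : C⦄ (φ : A ⟶ B), U.map φ =
      unitLinearMap hS.isFrobenioid τ hS.metricallyTrivial hS.autAmple (powEnd Φ d)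
        hS.frobeniusNormalized φ :=
    fun A B φ => (isPsiValue_iff hS.isFrobenioid τ hS.metricallyTrivial hS.autAmple
      hS.frobeniusNormalized d φ _).mp (hU φ)
  cases U
  unfold unitLinearFrobeniusData
  congr
  funext A B φ
  exact hmap φ

/-- **Row P25-L08 `PsiEquivalence` DISCHARGED**: a unit-linear Frobenius datum realising the
`Ψ`-values is an equivalence `C ⥲ C(d)` ("essentially surjective, faithful, and full", p. 50
ll. 20–22; for the landed functor `unitLinearFrobeniusData_isEquivalence`: faithful by
`unitLinearMap_injective` — `d · (−)` is injective on the divisorial `Φ(A)` —, full by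
`exists_unitLinearMap_eq` [cf. assertion (i)], the identity on objects).
[cite: MochizukiFrdI2008, Prop. 2.5(iii) p.50] -/
theorem psiEquivalence_holds (τ : CharacteristicSplitting F) (d : ℕ+) :
    Literature.AlgebraicGeometry.Frobenioids.FrdI.P25.PsiEquivalence F τ d := by
  intro hS U hU
  rw [unitLinearFrobeniusData_eq_of_isPsiValue hS τ d U hU]
  exact unitLinearFrobeniusData_isEquivalence hS.isFrobenioid τ hS.metricallyTrivial hS.autAmple
    (powEnd Φ d) hS.frobeniusNormalized (powEnd_app_injective hS.isFrobenioid.isPreFrobenioid d)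

end FrdI.P25

end Literature.AlgebraicGeometry.Frobenioids
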